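import Mathlib.Tactic
import Summits.KontsevichZagierPeriods.Zeta5Search.CalibrationAperyRecurrence
import Summits.KontsevichZagierPeriods.Zeta5Search.SymmetricFamilyInnerSum
import Summits.KontsevichZagierPeriods.Zeta5Search.Certificates.Telescoping
import HarnessLib

/-!
# ζ(5) search — CALIBRATION REPLAY: Zeilberger's certificate for Apéry's numbers (cell `pub-zeta5`, certifier `cert-1`)

HONEST FRAMING: systematic search; no irrationality claim unless certified.

The replay pipeline of `Certificates/Telescoping.lean`, run end to end on the one family whose
answer is already in the tree. Input (as a telescoper would print it; van der Poorten, *A proof that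
Euler missed*, Math. Intelligencer 1 (1979) §7; Zeilberger 1991): for the hypergeometric term
`F(n,k) = C(n,k)² C(n+k,n)²`,

* TELESCOPER `(n+1)³ S_n² − P(n+1) S_n + … ` i.e. `(n+2)³ F(n+2,k) − P(n+1) F(n+1,k) + (n+1)³ F(n,k)`,
  `P(m) = 34m³ + 51m² + 27m + 5`;
* CERTIFICATE `R(n,k) = 4(2n+1)(k(2k+1) − (2n+1)²)` (a polynomial), `G(n,k) = R(n,k−1)F(n,k−1)`,
  `G(n,0) = 0`;
* TERMWISE `(n+2)³F(n+2,k) − P(n+1)F(n+1,k) + (n+1)³F(n,k) = G(n+1,k+1) − G(n+1,k)` (`apery_termwise`).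

Replay: (1) the CLEARED identity `apery_cleared` (divide by `β(n,j) = C(n+2,j+1)²C(n+j+1,n)²`,
multiply by `Z(n) = ((n+1)(n+2))²`) is a polynomial identity closed by `ring`; (2) four binomial
ratio lemmas re-attach the term (`Zn_aperyF_*`); (3) the kernel's `telescope₃_eq_zero` +
`sum_range_eq_of_vanish` give **Apéry's recurrence for `bₙ = Σ_{k≤n} C(n,k)²C(n+k,n)²`**
(`aperyB_rec`, all `n`); (4) `eq_of_rec₂` identifies `bₙ` with the diagonal `q_{n,n}` of the tree's
Apéry table (`aperyB_eq_qT`, initial values `1, 5`) — so the replayed sum IS the `u` of the landed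
FORMAT A′ instance `CalibrationAperyRecurrence.aperyRecurrenceCertificate` (`certificate_u_eq_aperyB`),
whose growth box, integrality, limit and margin then apply verbatim: `Irrational (zetaValue 3)` as an
`example` routed through the replayed sum. By-product: `q_{n,n}` is the classical binomial sum, hence a
natural number, independently of Rajkumar's integrality engine (`qT_diag_eq_natCast`).

Second implementation of the certificate check: exact integer arithmetic, `n ≤ 14`, all `k`
(cell HOME `cert-1/apery_cert_check.py`). No named facts; standard axioms.
-/

namespace Summit.KontsevichZagierPeriods.Zeta5Search.Certificates

open Finset
open Summit.KontsevichZagierPeriods.Zeta5Search.SymmetricRecursion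
  (choose_succ_left_cast choose_succ_right_cast choose_add_succ_left_cast)
open Literature.NumberTheory.Transcendental.Apery (table qT boundary_one diag_succ table_zero_left)

namespace AperyReplay

/-! ### The data: term, sum, telescoper, certificate -/

/-- Apéry's hypergeometric summand `F(n,k) = C(n,k)² C(n+k,n)²` (as a rational). -/
def aperyF (n k : ℕ) : ℚ := ((n.choose k : ℕ) : ℚ) ^ 2 * (((n + k).choose n : ℕ) : ℚ) ^ 2

/-- Apéry's numbers `bₙ = Σ_{k ≤ n} C(n,k)² C(n+k,n)²` (`1, 5, 73, 1445, 33001, …`). -/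
def aperyB (n : ℕ) : ℚ := ∑ k ∈ range (n + 1), aperyF n k

/-- The telescoper's middle coefficient `P(m) = 34m³ + 51m² + 27m + 5`. -/
def aperyP (m : ℚ) : ℚ := 34 * m ^ 3 + 51 * m ^ 2 + 27 * m + 5

/-- Zeilberger's certificate `R(n,k) = 4(2n+1)(k(2k+1) − (2n+1)²)` — a polynomial multiplier. -/
def aperyR (n k : ℚ) : ℚ := 4 * (2 * n + 1) * (k * (2 * k + 1) - (2 * n + 1) ^ 2)

/-- The certificate function `G(n,k) = R(n,k−1) F(n,k−1)`, `G(n,0) = 0`. -/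
def aperyG (n : ℕ) : ℕ → ℚ
  | 0 => 0
  | j + 1 => aperyR n j * aperyF n j

/-- The common hypergeometric unit `β(n,j) = C(n+2,j+1)² C(n+j+1,n)²` of the column `k = j+1`. -/
def base (n j : ℕ) : ℚ :=
  (((n + 2).choose (j + 1) : ℕ) : ℚ) ^ 2 * (((n + (j + 1)).choose n : ℕ) : ℚ) ^ 2

/-- The normaliser `Z(n) = ((n+1)(n+2))²`. -/
def Zn (n : ℚ) : ℚ := ((n + 1) * (n + 2)) ^ 2

/-- `Z(n) ≠ 0`. -/
theorem Zn_ne_zero (n : ℕ) : Zn (n : ℚ) ≠ 0 := by unfold Zn; positivity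

/-! ### Step 1 — the cleared certificate identity (pure polynomial algebra) -/

/-- **Cleared identity** (with `N = n+1`, `K = j+1`):
`(N+1)³(N+K)²(N+K+1)² − P(N)(N+1−K)²(N+K)² + N³(N+1−K)²(N−K)² = R(N,K)(N+1−K)²(N+K)² − R(N,K−1)K⁴`. -/
theorem apery_cleared (N K : ℚ) :
    (N + 1) ^ 3 * ((N + K) ^ 2 * (N + K + 1) ^ 2) - aperyP N * ((N + 1 - K) ^ 2 * (N + K) ^ 2)
        + N ^ 3 * ((N + 1 - K) ^ 2 * (N - K) ^ 2)
      = aperyR N K * ((N + 1 - K) ^ 2 * (N + K) ^ 2) - aperyR N (K - 1) * K ^ 4 := by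
  unfold aperyP aperyR; ring

/-! ### Step 2 — re-attaching the hypergeometric term: `Z(n)·F(n+i, j+1)` and `Z(n)·F(n+1, j)` over `β(n,j)` -/

/-- `Z(n)·F(n+2,j+1) = β(n,j)·(n+j+2)²(n+j+3)²`. -/
theorem Zn_aperyF_two (n j : ℕ) :
    Zn n * aperyF (n + 2) (j + 1) = base n j * (((n : ℚ) + j + 2) ^ 2 * ((n : ℚ) + j + 3) ^ 2) := by
  have h1 := choose_add_succ_left_cast (n + 1) (j + 1)
  have h2 := choose_add_succ_left_cast n (j + 1)
  unfold Zn aperyF base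
  rw [show n + 2 + (j + 1) = n + 1 + 1 + (j + 1) from rfl]
  push_cast at h1 h2 ⊢
  set a := (((n + 2).choose (j + 1) : ℕ) : ℚ)
  set c2 := (((n + 1 + 1 + (j + 1)).choose (n + 1 + 1) : ℕ) : ℚ)
  set c1 := (((n + 1 + (j + 1)).choose (n + 1) : ℕ) : ℚ)
  set c0 := (((n + (j + 1)).choose n : ℕ) : ℚ)
  have e : c2 * (((n : ℚ) + 1) * ((n : ℚ) + 2)) = c0 * (((n : ℚ) + j + 2) * ((n : ℚ) + j + 3)) := by
    linear_combination ((n : ℚ) + 1) * h1 + ((n : ℚ) + 1 + (j + 1) + 1) * h2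
  calc (((n : ℚ) + 1) * ((n : ℚ) + 2)) ^ 2 * (a ^ 2 * c2 ^ 2)
      = a ^ 2 * (c2 * (((n : ℚ) + 1) * ((n : ℚ) + 2))) ^ 2 := by ring
    _ = a ^ 2 * (c0 * (((n : ℚ) + j + 2) * ((n : ℚ) + j + 3))) ^ 2 := by rw [e]
    _ = a ^ 2 * c0 ^ 2 * (((n : ℚ) + j + 2) ^ 2 * ((n : ℚ) + j + 3) ^ 2) := by ring

/-- `Z(n)·F(n+1,j+1) = β(n,j)·(n+1−j)²(n+j+2)²`. -/
theorem Zn_aperyF_one (n j : ℕ) :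
    Zn n * aperyF (n + 1) (j + 1) = base n j * (((n : ℚ) + 1 - j) ^ 2 * ((n : ℚ) + j + 2) ^ 2) := by
  have h1 := choose_succ_left_cast (n + 1) (j + 1)
  have h2 := choose_add_succ_left_cast n (j + 1)
  unfold Zn aperyF base
  push_cast at h1 h2 ⊢
  set a := (((n + 2).choose (j + 1) : ℕ) : ℚ)
  set a1 := (((n + 1).choose (j + 1) : ℕ) : ℚ)
  set c1 := (((n + 1 + (j + 1)).choose (n + 1) : ℕ) : ℚ)
  set c0 := (((n + (j + 1)).choose n : ℕ) : ℚ)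
  have e1 : a1 * ((n : ℚ) + 2) = a * ((n : ℚ) + 1 - j) := by linear_combination -h1
  have e2 : c1 * ((n : ℚ) + 1) = c0 * ((n : ℚ) + j + 2) := by linear_combination h2
  calc (((n : ℚ) + 1) * ((n : ℚ) + 2)) ^ 2 * (a1 ^ 2 * c1 ^ 2)
      = (a1 * ((n : ℚ) + 2)) ^ 2 * (c1 * ((n : ℚ) + 1)) ^ 2 := by ring
    _ = (a * ((n : ℚ) + 1 - j)) ^ 2 * (c0 * ((n : ℚ) + j + 2)) ^ 2 := by rw [e1, e2]
    _ = a ^ 2 * c0 ^ 2 * (((n : ℚ) + 1 - j) ^ 2 * ((n : ℚ) + j + 2) ^ 2) := by ring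

/-- `Z(n)·F(n,j+1) = β(n,j)·(n+1−j)²(n−j)²`. -/
theorem Zn_aperyF_zero (n j : ℕ) :
    Zn n * aperyF n (j + 1) = base n j * (((n : ℚ) + 1 - j) ^ 2 * ((n : ℚ) - j) ^ 2) := by
  have h1 := choose_succ_left_cast (n + 1) (j + 1)
  have h0 := choose_succ_left_cast n (j + 1)
  unfold Zn aperyF base
  push_cast at h1 h0 ⊢
  set a := (((n + 2).choose (j + 1) : ℕ) : ℚ)
  set a1 := (((n + 1).choose (j + 1) : ℕ) : ℚ)
  set a0 := ((n.choose (j + 1) : ℕ) : ℚ)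
  set c0 := (((n + (j + 1)).choose n : ℕ) : ℚ)
  have e : a0 * (((n : ℚ) + 1) * ((n : ℚ) + 2)) = a * (((n : ℚ) + 1 - j) * ((n : ℚ) - j)) := by
    linear_combination (-((n : ℚ) + 2)) * h0 + (-((n : ℚ) - j)) * h1
  calc (((n : ℚ) + 1) * ((n : ℚ) + 2)) ^ 2 * (a0 ^ 2 * c0 ^ 2)
      = (a0 * (((n : ℚ) + 1) * ((n : ℚ) + 2))) ^ 2 * c0 ^ 2 := by ring
    _ = (a * (((n : ℚ) + 1 - j) * ((n : ℚ) - j))) ^ 2 * c0 ^ 2 := by rw [e]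
    _ = a ^ 2 * c0 ^ 2 * (((n : ℚ) + 1 - j) ^ 2 * ((n : ℚ) - j) ^ 2) := by ring

/-- `Z(n)·F(n+1,j) = β(n,j)·(j+1)⁴` (the certificate's own column shift). -/
theorem Zn_aperyF_one_pred (n j : ℕ) :
    Zn n * aperyF (n + 1) j = base n j * ((j : ℚ) + 1) ^ 4 := by
  have h1 : (((n + 1).choose j : ℕ) : ℚ) * ((n : ℚ) + 2) = (((n + 2).choose (j + 1) : ℕ) : ℚ) * ((j : ℚ) + 1) := by
    have e := Nat.add_one_mul_choose_eq (n + 1) j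
    have e' : (((n + 1 + 1) * (n + 1).choose j : ℕ) : ℚ) = (((n + 1 + 1).choose (j + 1) * (j + 1) : ℕ) : ℚ) := by
      exact_mod_cast e
    push_cast at e'
    linear_combination e'
  have h2 := choose_succ_right_cast (n + 1 + j) n
  unfold Zn aperyF base
  rw [show n + (j + 1) = n + 1 + j by omega]
  push_cast at h2 ⊢
  set a := (((n + 2).choose (j + 1) : ℕ) : ℚ)
  set a' := (((n + 1).choose j : ℕ) : ℚ)
  set c1 := (((n + 1 + j).choose (n + 1) : ℕ) : ℚ)
  set c0 := (((n + 1 + j).choose n : ℕ) : ℚ)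
  have e2 : c1 * ((n : ℚ) + 1) = c0 * ((j : ℚ) + 1) := by linear_combination h2
  calc (((n : ℚ) + 1) * ((n : ℚ) + 2)) ^ 2 * (a' ^ 2 * c1 ^ 2)
      = (a' * ((n : ℚ) + 2)) ^ 2 * (c1 * ((n : ℚ) + 1)) ^ 2 := by ring
    _ = (a * ((j : ℚ) + 1)) ^ 2 * (c0 * ((j : ℚ) + 1)) ^ 2 := by rw [h1, e2]
    _ = a ^ 2 * c0 ^ 2 * ((j : ℚ) + 1) ^ 4 := by ring

/-! ### The termwise identity -/

/-- `F(m,0) = 1`. -/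
theorem aperyF_zero_right (m : ℕ) : aperyF m 0 = 1 := by simp [aperyF]

/-- **Termwise certificate identity** (all `n, k`):
`(n+2)³F(n+2,k) − P(n+1)F(n+1,k) + (n+1)³F(n,k) = G(n+1,k+1) − G(n+1,k)`. -/
theorem apery_termwise (n k : ℕ) :
    ((n : ℚ) + 1) ^ 3 * aperyF n k + (-aperyP ((n : ℚ) + 1)) * aperyF (n + 1) k
        + ((n : ℚ) + 2) ^ 3 * aperyF (n + 2) k = aperyG (n + 1) (k + 1) - aperyG (n + 1) k := by
  rcases k with _ | j
  · -- column `k = 0`: `(n+2)³ − P(n+1) + (n+1)³ = R(n+1,0)`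
    simp only [aperyG, aperyF_zero_right, Nat.cast_zero, mul_one, sub_zero]
    unfold aperyP aperyR; push_cast; ring
  · -- column `k = j+1`: cleared identity × `β(n,j)/Z(n)`
    have hZ := Zn_ne_zero n
    apply mul_left_cancel₀ hZ
    have h2 := Zn_aperyF_two n j
    have h1 := Zn_aperyF_one n j
    have h0 := Zn_aperyF_zero n j
    have hp := Zn_aperyF_one_pred n j
    have hc := apery_cleared ((n : ℚ) + 1) ((j : ℚ) + 1)
    simp only [aperyG]
    push_cast
    have eK : ((j : ℚ) + 1 - 1) = j := by ring
    rw [eK] at hc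
    linear_combination ((n : ℚ) + 1) ^ 3 * h0 + (-aperyP ((n : ℚ) + 1)) * h1 + ((n : ℚ) + 2) ^ 3 * h2
      + (-aperyR ((n : ℚ) + 1) ((j : ℚ) + 1)) * h1 + aperyR ((n : ℚ) + 1) j * hp + base n j * hc

/-! ### Step 3 — summation: Apéry's recurrence for the binomial sum -/

/-- Natural boundary: `F(m,k) = 0` for `k > m`. -/
theorem aperyF_eq_zero {m k : ℕ} (h : m + 1 ≤ k) : aperyF m k = 0 := by
  simp [aperyF, Nat.choose_eq_zero_of_lt (by omega : m < k)]

/-- Top boundary of the certificate: `G(n+1, n+3) = R·F(n+1,n+2) = 0`. -/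
theorem aperyG_top (n : ℕ) : aperyG (n + 1) (n + 3) = 0 := by
  simp [aperyG, aperyF_eq_zero (le_refl (n + 2))]

/-- **Apéry's recurrence for `bₙ = Σ C(n,k)²C(n+k,n)²`, all `n`** (replayed certificate):
`(n+2)³ b_{n+2} = (34(n+1)³ + 51(n+1)² + 27(n+1) + 5) b_{n+1} − (n+1)³ bₙ`. -/
theorem aperyB_rec (n : ℕ) :
    ((n : ℚ) + 2) ^ 3 * aperyB (n + 2) =
      (34 * ((n : ℚ) + 1) ^ 3 + 51 * ((n : ℚ) + 1) ^ 2 + 27 * ((n : ℚ) + 1) + 5) * aperyB (n + 1)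
        - ((n : ℚ) + 1) ^ 3 * aperyB n := by
  have h := telescope₃_eq_zero (((n : ℚ) + 1) ^ 3) (-aperyP ((n : ℚ) + 1)) (((n : ℚ) + 2) ^ 3)
    (aperyF n) (aperyF (n + 1)) (aperyF (n + 2)) (aperyG (n + 1)) (n + 3)
    (fun k _ => apery_termwise n k) rfl (aperyG_top n)
  rw [sum_range_eq_of_vanish (aperyF n) (by omega : n + 1 ≤ n + 3) (fun k hk => aperyF_eq_zero hk),
    sum_range_eq_of_vanish (aperyF (n + 1)) (by omega : n + 2 ≤ n + 3) (fun k hk => aperyF_eq_zero hk)] at h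
  unfold aperyB
  unfold aperyP at h
  linear_combination h

/-! ### Step 4 — identification with the tree's Apéry table and the landed certificate -/

/-- `b₀ = 1`. -/
theorem aperyB_zero : aperyB 0 = 1 := by
  simp [aperyB, aperyF]

/-- `b₁ = 5`. -/
theorem aperyB_one : aperyB 1 = 5 := by
  simp [aperyB, aperyF, Finset.sum_range_succ]
  norm_num

/-- `q_{0,0} = 1` in the tree's Apéry table. -/
theorem qT_zero_zero : qT 0 0 = 1 := by
  simp [qT]

/-- `q_{1,1} = 5` in the tree's Apéry table. -/
theorem qT_one_one : qT 1 1 = 5 := by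
  have h := diag_succ (r := fun _ => (1 : ℚ)) 0
  simp only [zero_add, table_zero_left] at h
  unfold qT
  rw [h]
  norm_num [Literature.NumberTheory.Transcendental.Apery.table]

/-- **Identification**: the binomial sum `bₙ` is the diagonal `q_{n,n}` of the tree's Apéry table
(same recurrence — replayed here, `CalibrationAperyRecurrence.diag_rec` there — same initial values). -/
theorem aperyB_eq_qT : aperyB = fun n => qT n n := by
  refine eq_of_rec₂ (a := fun n => ((n : ℚ) + 2) ^ 3)
    (b := fun n => 34 * ((n : ℚ) + 1) ^ 3 + 51 * ((n : ℚ) + 1) ^ 2 + 27 * ((n : ℚ) + 1) + 5)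
    (c := fun n => -((n : ℚ) + 1) ^ 3) (fun n => by positivity) (fun n => ?_) (fun n => ?_) ?_ ?_
  · rw [aperyB_rec]; ring
  · have h := CalibrationAperyRecurrence.diag_rec boundary_one n
    unfold qT
    rw [h]; ring
  · rw [aperyB_zero, qT_zero_zero]
  · rw [aperyB_one, qT_one_one]

/-- Pointwise form: `bₙ = q_{n,n}`. -/
theorem aperyB_eq_qT_apply (n : ℕ) : aperyB n = qT n n := congrFun aperyB_eq_qT n

/-- The replayed sum is literally the `u` of the landed FORMAT A′ instance
`CalibrationAperyRecurrence.aperyRecurrenceCertificate`. -/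
theorem certificate_u_eq_aperyB :
    CalibrationAperyRecurrence.aperyRecurrenceCertificate.u = aperyB := by
  funext n
  rw [aperyB_eq_qT_apply]
  rfl

/-- By-product: the diagonal of the Apéry table is the classical binomial sum, a natural number. -/
theorem qT_diag_eq_natCast (n : ℕ) :
    qT n n = ((∑ k ∈ range (n + 1), (n.choose k) ^ 2 * ((n + k).choose n) ^ 2 : ℕ) : ℚ) := by
  rw [← aperyB_eq_qT_apply]
  unfold aperyB aperyF
  push_cast
  rfl

/-- End-to-end: `ζ(3) ∉ ℚ` through the certificate whose `u` is the replayed binomial sum (an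
`example`; the statement is the tree's `Apery.irrational_zeta_three`). -/
example : Irrational (Literature.NumberTheory.Transcendental.zetaValue 3) :=
  CalibrationAperyRecurrence.aperyRecurrenceCertificate.irrational

end AperyReplay

end Summit.KontsevichZagierPeriods.Zeta5Search.Certificates
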